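/-
Copyright: the b2b-balaban T⁴-continuum CRUX team, row NE7b OWNER lineage `t4-ne7b-p1` (gen 144). Project licence.
-/
import Summits.QuantumFields.BalabanUV.T4Continuum.Spine.NE7b.SupFifthCumulantEntryTilted
import Summits.QuantumFields.BalabanUV.T4Continuum.Spine.NE7b.SupFifthFormGroupFive
import Summits.QuantumFields.BalabanUV.T4Continuum.Spine.NE7b.SupHessFourthCumulantEntriesTilted
import Summits.QuantumFields.BalabanUV.T4Continuum.Spine.NE7b.SupFifthKernelSums
import Summits.QuantumFields.BalabanUV.T4Continuum.Spine.NE7b.SupFifthKernelEntryGlue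

/-!
# THE ORDER-FIVE ENTRY MAJORANT, GROUP FIVE (the order-5 block of the kernel-letter CLASS MAP): to ITERATE, the fifth derivative
# must re-enter in the input format `|U⁽⁵⁾(φ)[e_u,e_x,e_y,e_z,e_t]| ≤ K5_{xyztu}` for ALL backgrounds — a BACKGROUND-FREE entrywise majorant.
# For `Γ = AAᵀ`, the derivative along `e_x` of the fifth group of (521)'s centred display (`u₄(U′y,U′z,U′t,U′s)`) at `(e_y,e_z,e_t,e_s)` is bounded
# ENTRYWISE:
# (594) gives it as 4 + 1 placements, each bounded by a piece ENTRY bound at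
# the placement's indices ((604) supported `u₄` tree entries ×4; (605) the fifth cumulant's fifteen-cut threshold entry; letter constants) after
# moving the tilt factor `A_x` to the front ((606), pointwise).  The majorant is WRITTEN OUT and does not depend on `ψ`
# (row NE7b, node U5c; (594) (595) (604) (605) (606) BY NAME; [folklore])

Cell `pub-balaban`, sub-cell `t4`, spine estimate NE7b (`T4WeightBudget.RelWeightBound`; the cell's OWN estimate — NOT PRINTED in
[Bałaban 1983–89], NOT PROVED).  Crux-route work under `Spine/NE7b/` by the row OWNER (`t4-ne7b-p1` gen 144, file (609)) under FREEZE
(0)'s crux-prover clause; NOTHING of Bałaban's is named as a Lean object, valued or asserted; no `T4Continuum/Support` leaf typed; no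
`def`, no notation (group functions WRITTEN OUT under `deriv`, the majorant WRITTEN OUT); zero `sorry`.

WHAT IS PROVED ([folklore]): **`fifth_entry_group_u4`**; toy.

HONEST (what this is NOT).  Group five only; the END and the slot letters are the next files.  The constants `C3k, C3h, C4, C5` are LETTERS above the
pieces' written-out constants (hypotheses); `D`'s letters, the weights and the profiles are hypotheses.  Scalar skeleton ((A3), NC-NE7b-α
UNRULED); nothing of Bałaban's asserted.  BY-NAME EFFECT ON THE WALL: NONE.  NE7b NOT PRINTED ∕ NOT PROVED; spine PROVED 0∕9; rung (B)+1 — the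
programme's measures remain FINITE-torus statements; NOT the mass gap, NOT Clay.  HONEST DEPENDENCY: continuum YM on T⁴ ⇐ BetaPertH ∧ nine spine
estimates (0∕9 proved); BetaPertH ⇐ (D1) ∧ (D4) ∧ CAP+tail; G-an2-4 gates asym, D1 and NE2∕3∕4.
-/

set_option autoImplicit false
set_option maxSynthPendingDepth 4

noncomputable section

namespace Summit.QuantumFields.BalabanUV.T4Continuum.NE7b.SupFifthKernelEntryGroupFive

open MeasureTheory ProbabilityTheory Finset Real Matrix
open scoped BigOperators Matrix
open SupEffectiveActionDerivative (mul_opBound_le_of_le)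
open SupWhitenedMomentLetters (posSemidef_AAT)
open SupFifthKernelSums (abs_split_cov4 abs_split_cov3 abs_split_kappa3 abs_split_u4)
open SupFifthKernelEntryGlue (cov_symm_pt cm3_cyc_pt cm3_swap12_pt cm3_swap13_pt u4_cyc_pt u4_4213_pt u4_swap12_pt u4_3124_pt u5_cyc_pt)
open SupFifthCumulantEntryTilted (fifth_cumulant_entry_tilted)
open SupFifthFormGroupFive (hasDerivAt_display4_u4_line)
open SupHessFourthCumulantEntriesTilted (hess_fourth_cumulant_entry_tilted)

variable {ι κ : Type} [Fintype ι] [DecidableEq ι] [Fintype κ] [DecidableEq κ]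

variable {U : EuclideanSpace ℝ ι → ℝ} {U' : EuclideanSpace ℝ ι → EuclideanSpace ℝ ι →L[ℝ] ℝ}
  {U'' : EuclideanSpace ℝ ι → EuclideanSpace ℝ ι →L[ℝ] EuclideanSpace ℝ ι →L[ℝ] ℝ}
  {U₃ : EuclideanSpace ℝ ι → EuclideanSpace ℝ ι →L[ℝ] EuclideanSpace ℝ ι →L[ℝ] EuclideanSpace ℝ ι →L[ℝ] ℝ}
  {U₄ : EuclideanSpace ℝ ι → EuclideanSpace ℝ ι →L[ℝ] EuclideanSpace ℝ ι →L[ℝ] EuclideanSpace ℝ ι →L[ℝ] EuclideanSpace ℝ ι →L[ℝ] ℝ}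
  {U₅ : EuclideanSpace ℝ ι →
    EuclideanSpace ℝ ι →L[ℝ] EuclideanSpace ℝ ι →L[ℝ] EuclideanSpace ℝ ι →L[ℝ] EuclideanSpace ℝ ι →L[ℝ] EuclideanSpace ℝ ι →L[ℝ] ℝ}
  {Hk : ι → ι → ℝ} {K3 : ι → ι → ι → ℝ} {K4 : ι → ι → ι → ι → ℝ} {K5 : ι → ι → ι → ι → ι → ℝ} {A : Matrix ι κ ℝ} {D : κ → κ → ℝ}
  {γop κ₀ κ₁ κ₂ κ₃ κ₄ κ₅ κ₅r a τ δ θp lam lamA αr αc hr hc k3r k3c k4r k4c k5r k5c γ dr dc dθ dθ' αθ βθ S S' S₁ n₃ : ℝ} {θ : κ → κ → ℝ}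
  {σ : ι → κ → ℝ} {ρ r : ι → ι → ℝ} {C3k C3h C4 C5 : ℝ}

set_option synthInstance.maxHeartbeats 200000 in
set_option maxHeartbeats 1600000 in
set_option maxRecDepth 4096 in
/-- **Group five, entrywise**: four supported `u₄(U″x·,U′,U′,U′)` tree entries ((604)) and the fifth cumulant's threshold entry ((605)). [folklore] -/
theorem fifth_entry_group_u4 [Nonempty κ]
    (hΓop : (γop • (1 : Matrix ι ι ℝ) - A * Aᵀ).PosSemidef) (Y : Finset ι) (hUd : ∀ φ : EuclideanSpace ℝ ι, HasFDerivAt U (U' φ) φ)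
    (hU'd : ∀ φ : EuclideanSpace ℝ ι, HasFDerivAt U' (U'' φ) φ) (hU''d : ∀ φ : EuclideanSpace ℝ ι, HasFDerivAt U'' (U₃ φ) φ)
    (hU₃d : ∀ φ : EuclideanSpace ℝ ι, HasFDerivAt U₃ (U₄ φ) φ) (hκ₀ : 0 ≤ κ₀) (hκ₁ : 0 ≤ κ₁) (ha : 0 ≤ a) (hτ : 0 < τ) (hδ : 0 < δ) (hθ0 : 0 < θp)
    (hθ1 : θp < 1) (hκθ : (2 * κ₀ * (1 + τ) + 4 * δ) * γop ≤ θp) (hκθw : 2 * κ₀ * (1 + τ) * γop + 4 * δ ≤ θp)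
    (hstab : ∀ φ : EuclideanSpace ℝ ι, -(κ₀ * ∑ x ∈ Y, φ x ^ 2) ≤ U φ) (hU'b : ∀ φ : EuclideanSpace ℝ ι, ‖U' φ‖ ≤ κ₁ * (a + ∑ x ∈ Y, φ x ^ 2))
    (hU''b : ∀ φ : EuclideanSpace ℝ ι, ‖U'' φ‖ ≤ κ₂) (hU₃b : ∀ φ : EuclideanSpace ℝ ι, ‖U₃ φ‖ ≤ κ₃) (hlam : 0 ≤ lam)
    (hUsec : ∀ s : ℝ, 0 ≤ s → s ≤ 1 → ∀ a b : EuclideanSpace ℝ ι,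
      U ((1 - s) • a + s • b) - lam / 2 * (s * (1 - s)) * ∑ i, (a i - b i) ^ 2 ≤ (1 - s) * U a + s * U b)
    (hρg : lam * γop < 1)
    (hHk : ∀ (φ : EuclideanSpace ℝ ι) (x z : ι), |U'' φ (EuclideanSpace.single z (1 : ℝ)) (EuclideanSpace.single x (1 : ℝ))| ≤ Hk x z)
    (hHk0 : ∀ v u, 0 ≤ Hk v u)
    (hK3 : ∀ (φ : EuclideanSpace ℝ ι) (u x y : ι),
      |U₃ φ (EuclideanSpace.single u (1 : ℝ)) (EuclideanSpace.single x (1 : ℝ)) (EuclideanSpace.single y (1 : ℝ))| ≤ K3 x y u)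
    (hK30 : ∀ x y u, 0 ≤ K3 x y u) (hhr : ∀ v, ∑ u, Hk v u ≤ hr) (ψ : EuclideanSpace ℝ ι) (hαr : ∀ u, ∑ w, |A u w| ≤ αr)
    (hαc : ∀ w, ∑ u, |A u w| ≤ αc) (hlamA : ∀ x : κ, ∑ u, ∑ v, |A u x| * |A v x| * Hk v u ≤ lamA) (hlamA1 : lamA < 1)
    (hγ : αc * hr * αr / (1 - lamA) ≤ γ) (hγ1 : γ < 1) (hD : ∀ x y, 0 ≤ D x y)
    (hDC : ∀ x y, (if x = y then (1 : ℝ) else 0) + ∑ z, D x z * ((if y = z then 0 else ∑ u, ∑ v, |A u y| * |A v z| * Hk v u) / (1 - lamA)) ≤ D x y)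
    (hθnn : ∀ z w, 0 ≤ θ z w) (hDθr : ∀ z, ∑ w, D z w * θ z w ≤ dθ) (hdθ : 0 ≤ dθ) (hDθc : ∀ w, ∑ z, D z w * θ z w ≤ dθ') (hdθ' : 0 ≤ dθ')
    (hσ0 : ∀ x w, 0 ≤ σ x w) (hσθ : ∀ x z w, σ x w ≤ σ x z * θ z w) (hr1 : ∀ x y, 1 ≤ r x y) (hrσ : ∀ x y w, r x y ^ 24 ≤ σ x w * σ y w)
    (haσ : ∀ v : ι, ∑ w, (∑ u, |A u w| * Hk v u) * σ v w ≤ αθ) (hβ : 0 ≤ βθ) (haσ' : ∀ (v : ι) (w : κ), (∑ u, |A u w| * Hk v u) * σ v w ≤ βθ)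
    (hgσ : ∀ p q : ι, ∑ w, (∑ u, |A u w| * K3 p q u) * σ p w ≤ αθ) (hgσ' : ∀ (p q : ι) (w : κ), (∑ u, |A u w| * K3 p q u) * σ p w ≤ βθ)
    (hC4 : (4 * (αθ * dθ * (βθ * dθ') / (1 - lamA)) + 3 * (αθ * dθ * (βθ * dθ') / (1 - lamA)) ^ 2 + 4 * (5 * ((κ₂ ^ 4 + κ₃ ^ 4) * γop ^ 2) / (1 - lam
        * γop) ^ 2) + 4 * (50 * ((κ₂ ^ 6 + κ₃ ^ 6) * γop ^ 3) / (1 - lam * γop) ^ 3) + 2 * (((5 * ((κ₂ ^ 4 + κ₃ ^ 4) * γop ^ 2) / (1 - lam * γop) ^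
        2) + 1) / 2) * ((((5 * ((κ₂ ^ 4 + κ₃ ^ 4) * γop ^ 2) / (1 - lam * γop) ^ 2) + 1) / 2) + (5 * ((κ₂ ^ 4 + κ₃ ^ 4) * γop ^ 2) / (1 - lam * γop)
        ^ 2))) ≤ C4)
    (hC5 : ((4 * (αθ * dθ * (βθ * dθ') / (1 - lamA)) + 5 * (50 * (κ₂ ^ 6 * γop ^ 3) / (1 - lam * γop) ^ 3) + (((5 * (κ₂ ^ 4 * γop ^ 2) / (1 - lam *
        γop) ^ 2) + 1) / 2) * (5 * (κ₂ ^ 4 * γop ^ 2) / (1 - lam * γop) ^ 2) + 2 * (αθ * dθ * (βθ * dθ') / (1 - lamA)) * ((((5 * (κ₂ ^ 4 * γop ^ 2) /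
        (1 - lam * γop) ^ 2) + 1) / 2) + (5 * (κ₂ ^ 4 * γop ^ 2) / (1 - lam * γop) ^ 2)) + 24 * (((5 * (κ₂ ^ 4 * γop ^ 2) / (1 - lam * γop) ^ 2) + 1)
        / 2) * Real.sqrt ((αθ * dθ * (βθ * dθ') / (1 - lamA)) * (5 * (κ₂ ^ 4 * γop ^ 2) / (1 - lam * γop) ^ 2))) + (6 * (αθ * dθ * (βθ * dθ') / (1 -
        lamA)) + 5 * (50 * (κ₂ ^ 6 * γop ^ 3) / (1 - lam * γop) ^ 3) + ((((5 * (κ₂ ^ 4 * γop ^ 2) / (1 - lam * γop) ^ 2) + 1) / 2) + (5 * (κ₂ ^ 4 *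
        γop ^ 2) / (1 - lam * γop) ^ 2)) ^ 2 / 2 + 3 * (((5 * (κ₂ ^ 4 * γop ^ 2) / (1 - lam * γop) ^ 2) + 1) / 2) * (5 * (κ₂ ^ 4 * γop ^ 2) / (1 -
        lam * γop) ^ 2) + 3 * (αθ * dθ * (βθ * dθ') / (1 - lamA)) * ((((5 * (κ₂ ^ 4 * γop ^ 2) / (1 - lam * γop) ^ 2) + 1) / 2) + (5 * (κ₂ ^ 4 * γop
        ^ 2) / (1 - lam * γop) ^ 2)) + 12 * (((5 * (κ₂ ^ 4 * γop ^ 2) / (1 - lam * γop) ^ 2) + 1) / 2) * Real.sqrt ((αθ * dθ * (βθ * dθ') / (1 -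
        lamA)) * (5 * (κ₂ ^ 4 * γop ^ 2) / (1 - lam * γop) ^ 2)))) ≤ C5)
    (x : ι) (y z t s : ι) :
    |deriv (fun σ : ℝ => (((∫ ω : EuclideanSpace ℝ ι, exp (-U (ω + (ψ + σ • EuclideanSpace.single x (1 : ℝ)))) ∂(multivariateGaussian 0 (A * Aᵀ)))⁻¹
        * (∫ ω : EuclideanSpace ℝ ι, exp (-U (ω + (ψ + σ • EuclideanSpace.single x (1 : ℝ)))) * ((U' (ω + (ψ + σ • EuclideanSpace.single x (1 : ℝ)))
        (EuclideanSpace.single y (1 : ℝ)) - ((∫ ω : EuclideanSpace ℝ ι, exp (-U (ω + (ψ + σ • EuclideanSpace.single x (1 : ℝ))))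
        ∂(multivariateGaussian 0 (A * Aᵀ)))⁻¹ * (∫ ω : EuclideanSpace ℝ ι, exp (-U (ω + (ψ + σ • EuclideanSpace.single x (1 : ℝ)))) * U' (ω + (ψ + σ
        • EuclideanSpace.single x (1 : ℝ))) (EuclideanSpace.single y (1 : ℝ)) ∂(multivariateGaussian 0 (A * Aᵀ))))) * (U' (ω + (ψ + σ •
        EuclideanSpace.single x (1 : ℝ))) (EuclideanSpace.single z (1 : ℝ)) - ((∫ ω : EuclideanSpace ℝ ι, exp (-U (ω + (ψ + σ • EuclideanSpace.single
        x (1 : ℝ)))) ∂(multivariateGaussian 0 (A * Aᵀ)))⁻¹ * (∫ ω : EuclideanSpace ℝ ι, exp (-U (ω + (ψ + σ • EuclideanSpace.single x (1 : ℝ)))) * U'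
        (ω + (ψ + σ • EuclideanSpace.single x (1 : ℝ))) (EuclideanSpace.single z (1 : ℝ)) ∂(multivariateGaussian 0 (A * Aᵀ))))) * (U' (ω + (ψ + σ •
        EuclideanSpace.single x (1 : ℝ))) (EuclideanSpace.single t (1 : ℝ)) - ((∫ ω : EuclideanSpace ℝ ι, exp (-U (ω + (ψ + σ • EuclideanSpace.single
        x (1 : ℝ)))) ∂(multivariateGaussian 0 (A * Aᵀ)))⁻¹ * (∫ ω : EuclideanSpace ℝ ι, exp (-U (ω + (ψ + σ • EuclideanSpace.single x (1 : ℝ)))) * U'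
        (ω + (ψ + σ • EuclideanSpace.single x (1 : ℝ))) (EuclideanSpace.single t (1 : ℝ)) ∂(multivariateGaussian 0 (A * Aᵀ))))) * (U' (ω + (ψ + σ •
        EuclideanSpace.single x (1 : ℝ))) (EuclideanSpace.single s (1 : ℝ)) - ((∫ ω : EuclideanSpace ℝ ι, exp (-U (ω + (ψ + σ • EuclideanSpace.single
        x (1 : ℝ)))) ∂(multivariateGaussian 0 (A * Aᵀ)))⁻¹ * (∫ ω : EuclideanSpace ℝ ι, exp (-U (ω + (ψ + σ • EuclideanSpace.single x (1 : ℝ)))) * U'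
        (ω + (ψ + σ • EuclideanSpace.single x (1 : ℝ))) (EuclideanSpace.single s (1 : ℝ)) ∂(multivariateGaussian 0 (A * Aᵀ))))))
        ∂(multivariateGaussian 0 (A * Aᵀ)))) - ((∫ ω : EuclideanSpace ℝ ι, exp (-U (ω + (ψ + σ • EuclideanSpace.single x (1 : ℝ))))
        ∂(multivariateGaussian 0 (A * Aᵀ)))⁻¹ * (∫ ω : EuclideanSpace ℝ ι, exp (-U (ω + (ψ + σ • EuclideanSpace.single x (1 : ℝ)))) * ((U' (ω + (ψ +
        σ • EuclideanSpace.single x (1 : ℝ))) (EuclideanSpace.single y (1 : ℝ)) - ((∫ ω : EuclideanSpace ℝ ι, exp (-U (ω + (ψ + σ •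
        EuclideanSpace.single x (1 : ℝ)))) ∂(multivariateGaussian 0 (A * Aᵀ)))⁻¹ * (∫ ω : EuclideanSpace ℝ ι, exp (-U (ω + (ψ + σ •
        EuclideanSpace.single x (1 : ℝ)))) * U' (ω + (ψ + σ • EuclideanSpace.single x (1 : ℝ))) (EuclideanSpace.single y (1 : ℝ))
        ∂(multivariateGaussian 0 (A * Aᵀ))))) * (U' (ω + (ψ + σ • EuclideanSpace.single x (1 : ℝ))) (EuclideanSpace.single z (1 : ℝ)) - ((∫ ω :
        EuclideanSpace ℝ ι, exp (-U (ω + (ψ + σ • EuclideanSpace.single x (1 : ℝ)))) ∂(multivariateGaussian 0 (A * Aᵀ)))⁻¹ * (∫ ω : EuclideanSpace ℝ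
        ι, exp (-U (ω + (ψ + σ • EuclideanSpace.single x (1 : ℝ)))) * U' (ω + (ψ + σ • EuclideanSpace.single x (1 : ℝ))) (EuclideanSpace.single z (1
        : ℝ)) ∂(multivariateGaussian 0 (A * Aᵀ)))))) ∂(multivariateGaussian 0 (A * Aᵀ)))) * ((∫ ω : EuclideanSpace ℝ ι, exp (-U (ω + (ψ + σ •
        EuclideanSpace.single x (1 : ℝ)))) ∂(multivariateGaussian 0 (A * Aᵀ)))⁻¹ * (∫ ω : EuclideanSpace ℝ ι, exp (-U (ω + (ψ + σ •
        EuclideanSpace.single x (1 : ℝ)))) * ((U' (ω + (ψ + σ • EuclideanSpace.single x (1 : ℝ))) (EuclideanSpace.single t (1 : ℝ)) - ((∫ ω :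
        EuclideanSpace ℝ ι, exp (-U (ω + (ψ + σ • EuclideanSpace.single x (1 : ℝ)))) ∂(multivariateGaussian 0 (A * Aᵀ)))⁻¹ * (∫ ω : EuclideanSpace ℝ
        ι, exp (-U (ω + (ψ + σ • EuclideanSpace.single x (1 : ℝ)))) * U' (ω + (ψ + σ • EuclideanSpace.single x (1 : ℝ))) (EuclideanSpace.single t (1
        : ℝ)) ∂(multivariateGaussian 0 (A * Aᵀ))))) * (U' (ω + (ψ + σ • EuclideanSpace.single x (1 : ℝ))) (EuclideanSpace.single s (1 : ℝ)) - ((∫ ω :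
        EuclideanSpace ℝ ι, exp (-U (ω + (ψ + σ • EuclideanSpace.single x (1 : ℝ)))) ∂(multivariateGaussian 0 (A * Aᵀ)))⁻¹ * (∫ ω : EuclideanSpace ℝ
        ι, exp (-U (ω + (ψ + σ • EuclideanSpace.single x (1 : ℝ)))) * U' (ω + (ψ + σ • EuclideanSpace.single x (1 : ℝ))) (EuclideanSpace.single s (1
        : ℝ)) ∂(multivariateGaussian 0 (A * Aᵀ)))))) ∂(multivariateGaussian 0 (A * Aᵀ)))) - ((∫ ω : EuclideanSpace ℝ ι, exp (-U (ω + (ψ + σ •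
        EuclideanSpace.single x (1 : ℝ)))) ∂(multivariateGaussian 0 (A * Aᵀ)))⁻¹ * (∫ ω : EuclideanSpace ℝ ι, exp (-U (ω + (ψ + σ •
        EuclideanSpace.single x (1 : ℝ)))) * ((U' (ω + (ψ + σ • EuclideanSpace.single x (1 : ℝ))) (EuclideanSpace.single y (1 : ℝ)) - ((∫ ω :
        EuclideanSpace ℝ ι, exp (-U (ω + (ψ + σ • EuclideanSpace.single x (1 : ℝ)))) ∂(multivariateGaussian 0 (A * Aᵀ)))⁻¹ * (∫ ω : EuclideanSpace ℝ
        ι, exp (-U (ω + (ψ + σ • EuclideanSpace.single x (1 : ℝ)))) * U' (ω + (ψ + σ • EuclideanSpace.single x (1 : ℝ))) (EuclideanSpace.single y (1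
        : ℝ)) ∂(multivariateGaussian 0 (A * Aᵀ))))) * (U' (ω + (ψ + σ • EuclideanSpace.single x (1 : ℝ))) (EuclideanSpace.single t (1 : ℝ)) - ((∫ ω :
        EuclideanSpace ℝ ι, exp (-U (ω + (ψ + σ • EuclideanSpace.single x (1 : ℝ)))) ∂(multivariateGaussian 0 (A * Aᵀ)))⁻¹ * (∫ ω : EuclideanSpace ℝ
        ι, exp (-U (ω + (ψ + σ • EuclideanSpace.single x (1 : ℝ)))) * U' (ω + (ψ + σ • EuclideanSpace.single x (1 : ℝ))) (EuclideanSpace.single t (1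
        : ℝ)) ∂(multivariateGaussian 0 (A * Aᵀ)))))) ∂(multivariateGaussian 0 (A * Aᵀ)))) * ((∫ ω : EuclideanSpace ℝ ι, exp (-U (ω + (ψ + σ •
        EuclideanSpace.single x (1 : ℝ)))) ∂(multivariateGaussian 0 (A * Aᵀ)))⁻¹ * (∫ ω : EuclideanSpace ℝ ι, exp (-U (ω + (ψ + σ •
        EuclideanSpace.single x (1 : ℝ)))) * ((U' (ω + (ψ + σ • EuclideanSpace.single x (1 : ℝ))) (EuclideanSpace.single z (1 : ℝ)) - ((∫ ω :
        EuclideanSpace ℝ ι, exp (-U (ω + (ψ + σ • EuclideanSpace.single x (1 : ℝ)))) ∂(multivariateGaussian 0 (A * Aᵀ)))⁻¹ * (∫ ω : EuclideanSpace ℝ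
        ι, exp (-U (ω + (ψ + σ • EuclideanSpace.single x (1 : ℝ)))) * U' (ω + (ψ + σ • EuclideanSpace.single x (1 : ℝ))) (EuclideanSpace.single z (1
        : ℝ)) ∂(multivariateGaussian 0 (A * Aᵀ))))) * (U' (ω + (ψ + σ • EuclideanSpace.single x (1 : ℝ))) (EuclideanSpace.single s (1 : ℝ)) - ((∫ ω :
        EuclideanSpace ℝ ι, exp (-U (ω + (ψ + σ • EuclideanSpace.single x (1 : ℝ)))) ∂(multivariateGaussian 0 (A * Aᵀ)))⁻¹ * (∫ ω : EuclideanSpace ℝ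
        ι, exp (-U (ω + (ψ + σ • EuclideanSpace.single x (1 : ℝ)))) * U' (ω + (ψ + σ • EuclideanSpace.single x (1 : ℝ))) (EuclideanSpace.single s (1
        : ℝ)) ∂(multivariateGaussian 0 (A * Aᵀ)))))) ∂(multivariateGaussian 0 (A * Aᵀ)))) - ((∫ ω : EuclideanSpace ℝ ι, exp (-U (ω + (ψ + σ •
        EuclideanSpace.single x (1 : ℝ)))) ∂(multivariateGaussian 0 (A * Aᵀ)))⁻¹ * (∫ ω : EuclideanSpace ℝ ι, exp (-U (ω + (ψ + σ •
        EuclideanSpace.single x (1 : ℝ)))) * ((U' (ω + (ψ + σ • EuclideanSpace.single x (1 : ℝ))) (EuclideanSpace.single y (1 : ℝ)) - ((∫ ω :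
        EuclideanSpace ℝ ι, exp (-U (ω + (ψ + σ • EuclideanSpace.single x (1 : ℝ)))) ∂(multivariateGaussian 0 (A * Aᵀ)))⁻¹ * (∫ ω : EuclideanSpace ℝ
        ι, exp (-U (ω + (ψ + σ • EuclideanSpace.single x (1 : ℝ)))) * U' (ω + (ψ + σ • EuclideanSpace.single x (1 : ℝ))) (EuclideanSpace.single y (1
        : ℝ)) ∂(multivariateGaussian 0 (A * Aᵀ))))) * (U' (ω + (ψ + σ • EuclideanSpace.single x (1 : ℝ))) (EuclideanSpace.single s (1 : ℝ)) - ((∫ ω :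
        EuclideanSpace ℝ ι, exp (-U (ω + (ψ + σ • EuclideanSpace.single x (1 : ℝ)))) ∂(multivariateGaussian 0 (A * Aᵀ)))⁻¹ * (∫ ω : EuclideanSpace ℝ
        ι, exp (-U (ω + (ψ + σ • EuclideanSpace.single x (1 : ℝ)))) * U' (ω + (ψ + σ • EuclideanSpace.single x (1 : ℝ))) (EuclideanSpace.single s (1
        : ℝ)) ∂(multivariateGaussian 0 (A * Aᵀ)))))) ∂(multivariateGaussian 0 (A * Aᵀ)))) * ((∫ ω : EuclideanSpace ℝ ι, exp (-U (ω + (ψ + σ •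
        EuclideanSpace.single x (1 : ℝ)))) ∂(multivariateGaussian 0 (A * Aᵀ)))⁻¹ * (∫ ω : EuclideanSpace ℝ ι, exp (-U (ω + (ψ + σ •
        EuclideanSpace.single x (1 : ℝ)))) * ((U' (ω + (ψ + σ • EuclideanSpace.single x (1 : ℝ))) (EuclideanSpace.single z (1 : ℝ)) - ((∫ ω :
        EuclideanSpace ℝ ι, exp (-U (ω + (ψ + σ • EuclideanSpace.single x (1 : ℝ)))) ∂(multivariateGaussian 0 (A * Aᵀ)))⁻¹ * (∫ ω : EuclideanSpace ℝ
        ι, exp (-U (ω + (ψ + σ • EuclideanSpace.single x (1 : ℝ)))) * U' (ω + (ψ + σ • EuclideanSpace.single x (1 : ℝ))) (EuclideanSpace.single z (1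
        : ℝ)) ∂(multivariateGaussian 0 (A * Aᵀ))))) * (U' (ω + (ψ + σ • EuclideanSpace.single x (1 : ℝ))) (EuclideanSpace.single t (1 : ℝ)) - ((∫ ω :
        EuclideanSpace ℝ ι, exp (-U (ω + (ψ + σ • EuclideanSpace.single x (1 : ℝ)))) ∂(multivariateGaussian 0 (A * Aᵀ)))⁻¹ * (∫ ω : EuclideanSpace ℝ
        ι, exp (-U (ω + (ψ + σ • EuclideanSpace.single x (1 : ℝ)))) * U' (ω + (ψ + σ • EuclideanSpace.single x (1 : ℝ))) (EuclideanSpace.single t (1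
        : ℝ)) ∂(multivariateGaussian 0 (A * Aᵀ)))))) ∂(multivariateGaussian 0 (A * Aᵀ)))))) 0| ≤
      (if Hk y x = 0 then 0 else C4 * (((r x z ^ 2)⁻¹ * (r x t ^ 2)⁻¹ * (r x s ^ 2)⁻¹ + (r x z ^ 2)⁻¹ * (r z t ^ 2)⁻¹ * (r z s ^ 2)⁻¹ + (r x t ^ 2)⁻¹
          * (r z t ^ 2)⁻¹ * (r t s ^ 2)⁻¹ + (r x s ^ 2)⁻¹ * (r z s ^ 2)⁻¹ * (r t s ^ 2)⁻¹ + (r x z ^ 2)⁻¹ * (r z t ^ 2)⁻¹ * (r t s ^ 2)⁻¹ + (r x z ^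
          2)⁻¹ * (r z s ^ 2)⁻¹ * (r t s ^ 2)⁻¹ + (r x t ^ 2)⁻¹ * (r z t ^ 2)⁻¹ * (r z s ^ 2)⁻¹ + (r x t ^ 2)⁻¹ * (r z s ^ 2)⁻¹ * (r t s ^ 2)⁻¹ + (r x
          s ^ 2)⁻¹ * (r z t ^ 2)⁻¹ * (r z s ^ 2)⁻¹ + (r x s ^ 2)⁻¹ * (r z t ^ 2)⁻¹ * (r t s ^ 2)⁻¹ + (r x z ^ 2)⁻¹ * (r x t ^ 2)⁻¹ * (r t s ^ 2)⁻¹ +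
          (r x z ^ 2)⁻¹ * (r x s ^ 2)⁻¹ * (r t s ^ 2)⁻¹ + (r x z ^ 2)⁻¹ * (r x t ^ 2)⁻¹ * (r z s ^ 2)⁻¹ + (r x t ^ 2)⁻¹ * (r x s ^ 2)⁻¹ * (r z s ^
          2)⁻¹ + (r x z ^ 2)⁻¹ * (r x s ^ 2)⁻¹ * (r z t ^ 2)⁻¹ + (r x t ^ 2)⁻¹ * (r x s ^ 2)⁻¹ * (r z t ^ 2)⁻¹)) : ℝ) +
        (if Hk z x = 0 then 0 else C4 * (((r x y ^ 2)⁻¹ * (r x t ^ 2)⁻¹ * (r x s ^ 2)⁻¹ + (r x y ^ 2)⁻¹ * (r y t ^ 2)⁻¹ * (r y s ^ 2)⁻¹ + (r x t ^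
            2)⁻¹ * (r y t ^ 2)⁻¹ * (r t s ^ 2)⁻¹ + (r x s ^ 2)⁻¹ * (r y s ^ 2)⁻¹ * (r t s ^ 2)⁻¹ + (r x y ^ 2)⁻¹ * (r y t ^ 2)⁻¹ * (r t s ^ 2)⁻¹ + (r
            x y ^ 2)⁻¹ * (r y s ^ 2)⁻¹ * (r t s ^ 2)⁻¹ + (r x t ^ 2)⁻¹ * (r y t ^ 2)⁻¹ * (r y s ^ 2)⁻¹ + (r x t ^ 2)⁻¹ * (r y s ^ 2)⁻¹ * (r t s ^
            2)⁻¹ + (r x s ^ 2)⁻¹ * (r y t ^ 2)⁻¹ * (r y s ^ 2)⁻¹ + (r x s ^ 2)⁻¹ * (r y t ^ 2)⁻¹ * (r t s ^ 2)⁻¹ + (r x y ^ 2)⁻¹ * (r x t ^ 2)⁻¹ * (r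
            t s ^ 2)⁻¹ + (r x y ^ 2)⁻¹ * (r x s ^ 2)⁻¹ * (r t s ^ 2)⁻¹ + (r x y ^ 2)⁻¹ * (r x t ^ 2)⁻¹ * (r y s ^ 2)⁻¹ + (r x t ^ 2)⁻¹ * (r x s ^
            2)⁻¹ * (r y s ^ 2)⁻¹ + (r x y ^ 2)⁻¹ * (r x s ^ 2)⁻¹ * (r y t ^ 2)⁻¹ + (r x t ^ 2)⁻¹ * (r x s ^ 2)⁻¹ * (r y t ^ 2)⁻¹)) : ℝ) +
        (if Hk t x = 0 then 0 else C4 * (((r x y ^ 2)⁻¹ * (r x z ^ 2)⁻¹ * (r x s ^ 2)⁻¹ + (r x y ^ 2)⁻¹ * (r y z ^ 2)⁻¹ * (r y s ^ 2)⁻¹ + (r x z ^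
            2)⁻¹ * (r y z ^ 2)⁻¹ * (r z s ^ 2)⁻¹ + (r x s ^ 2)⁻¹ * (r y s ^ 2)⁻¹ * (r z s ^ 2)⁻¹ + (r x y ^ 2)⁻¹ * (r y z ^ 2)⁻¹ * (r z s ^ 2)⁻¹ + (r
            x y ^ 2)⁻¹ * (r y s ^ 2)⁻¹ * (r z s ^ 2)⁻¹ + (r x z ^ 2)⁻¹ * (r y z ^ 2)⁻¹ * (r y s ^ 2)⁻¹ + (r x z ^ 2)⁻¹ * (r y s ^ 2)⁻¹ * (r z s ^
            2)⁻¹ + (r x s ^ 2)⁻¹ * (r y z ^ 2)⁻¹ * (r y s ^ 2)⁻¹ + (r x s ^ 2)⁻¹ * (r y z ^ 2)⁻¹ * (r z s ^ 2)⁻¹ + (r x y ^ 2)⁻¹ * (r x z ^ 2)⁻¹ * (r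
            z s ^ 2)⁻¹ + (r x y ^ 2)⁻¹ * (r x s ^ 2)⁻¹ * (r z s ^ 2)⁻¹ + (r x y ^ 2)⁻¹ * (r x z ^ 2)⁻¹ * (r y s ^ 2)⁻¹ + (r x z ^ 2)⁻¹ * (r x s ^
            2)⁻¹ * (r y s ^ 2)⁻¹ + (r x y ^ 2)⁻¹ * (r x s ^ 2)⁻¹ * (r y z ^ 2)⁻¹ + (r x z ^ 2)⁻¹ * (r x s ^ 2)⁻¹ * (r y z ^ 2)⁻¹)) : ℝ) +
        (if Hk s x = 0 then 0 else C4 * (((r x y ^ 2)⁻¹ * (r x z ^ 2)⁻¹ * (r x t ^ 2)⁻¹ + (r x y ^ 2)⁻¹ * (r y z ^ 2)⁻¹ * (r y t ^ 2)⁻¹ + (r x z ^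
            2)⁻¹ * (r y z ^ 2)⁻¹ * (r z t ^ 2)⁻¹ + (r x t ^ 2)⁻¹ * (r y t ^ 2)⁻¹ * (r z t ^ 2)⁻¹ + (r x y ^ 2)⁻¹ * (r y z ^ 2)⁻¹ * (r z t ^ 2)⁻¹ + (r
            x y ^ 2)⁻¹ * (r y t ^ 2)⁻¹ * (r z t ^ 2)⁻¹ + (r x z ^ 2)⁻¹ * (r y z ^ 2)⁻¹ * (r y t ^ 2)⁻¹ + (r x z ^ 2)⁻¹ * (r y t ^ 2)⁻¹ * (r z t ^
            2)⁻¹ + (r x t ^ 2)⁻¹ * (r y z ^ 2)⁻¹ * (r y t ^ 2)⁻¹ + (r x t ^ 2)⁻¹ * (r y z ^ 2)⁻¹ * (r z t ^ 2)⁻¹ + (r x y ^ 2)⁻¹ * (r x z ^ 2)⁻¹ * (r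
            z t ^ 2)⁻¹ + (r x y ^ 2)⁻¹ * (r x t ^ 2)⁻¹ * (r z t ^ 2)⁻¹ + (r x y ^ 2)⁻¹ * (r x z ^ 2)⁻¹ * (r y t ^ 2)⁻¹ + (r x z ^ 2)⁻¹ * (r x t ^
            2)⁻¹ * (r y t ^ 2)⁻¹ + (r x y ^ 2)⁻¹ * (r x t ^ 2)⁻¹ * (r y z ^ 2)⁻¹ + (r x z ^ 2)⁻¹ * (r x t ^ 2)⁻¹ * (r y z ^ 2)⁻¹)) : ℝ) +
        (C5 * (min (max (r x y)⁻¹ (max (r x z)⁻¹ (max (r x t)⁻¹ (r x s)⁻¹))) (min (max (r x z)⁻¹ (max (r y z)⁻¹ (max (r x t)⁻¹ (max (r y t)⁻¹ (max (r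
            x s)⁻¹ (r y s)⁻¹))))) (min (max (r x y)⁻¹ (max (r y z)⁻¹ (max (r x t)⁻¹ (max (r z t)⁻¹ (max (r x s)⁻¹ (r z s)⁻¹))))) (min (max (r x y)⁻¹
            (max (r y t)⁻¹ (max (r x z)⁻¹ (max (r z t)⁻¹ (max (r x s)⁻¹ (r t s)⁻¹))))) (min (max (r x y)⁻¹ (max (r y s)⁻¹ (max (r x z)⁻¹ (max (r z
            s)⁻¹ (max (r x t)⁻¹ (r t s)⁻¹))))) (min (max (r x t)⁻¹ (max (r y t)⁻¹ (max (r z t)⁻¹ (max (r x s)⁻¹ (max (r y s)⁻¹ (r z s)⁻¹))))) (min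
            (max (r x z)⁻¹ (max (r y z)⁻¹ (max (r z t)⁻¹ (max (r x s)⁻¹ (max (r y s)⁻¹ (r t s)⁻¹))))) (min (max (r x z)⁻¹ (max (r y z)⁻¹ (max (r z
            s)⁻¹ (max (r x t)⁻¹ (max (r y t)⁻¹ (r t s)⁻¹))))) (min (max (r x y)⁻¹ (max (r y z)⁻¹ (max (r y t)⁻¹ (max (r x s)⁻¹ (max (r z s)⁻¹ (r t
            s)⁻¹))))) (min (max (r x y)⁻¹ (max (r y z)⁻¹ (max (r y s)⁻¹ (max (r x t)⁻¹ (max (r z t)⁻¹ (r t s)⁻¹))))) (min (max (r x y)⁻¹ (max (r y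
            t)⁻¹ (max (r y s)⁻¹ (max (r x z)⁻¹ (max (r z t)⁻¹ (r z s)⁻¹))))) (min (max (r x s)⁻¹ (max (r y s)⁻¹ (max (r z s)⁻¹ (r t s)⁻¹))) (min (max
            (r x t)⁻¹ (max (r y t)⁻¹ (max (r z t)⁻¹ (r t s)⁻¹))) (min (max (r x z)⁻¹ (max (r y z)⁻¹ (max (r z t)⁻¹ (r z s)⁻¹))) (max (r x y)⁻¹ (max
            (r y z)⁻¹ (max (r y t)⁻¹ (r y s)⁻¹))))))))))))))))) ^ 4 : ℝ) := by
  have hΓ : (A * Aᵀ).PosSemidef := posSemidef_AAT A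
  have hU''c : Continuous U'' := continuous_iff_continuousAt.2 fun φ => (hU''d φ).continuousAt
  have hU₃c : Continuous U₃ := continuous_iff_continuousAt.2 fun φ => (hU₃d φ).continuousAt
  rw [(hasDerivAt_display4_u4_line hΓ hΓop Y hUd hU'd hU''c hκ₀ hκ₁ ha hτ hδ hθ0 hθ1 hκθ hstab hU'b hU''b ψ (EuclideanSpace.single x (1 : ℝ))
      (EuclideanSpace.single y (1 : ℝ)) (EuclideanSpace.single z (1 : ℝ)) (EuclideanSpace.single t (1 : ℝ)) (EuclideanSpace.single s (1 : ℝ))).deriv]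
  have h1 := hess_fourth_cumulant_entry_tilted hΓop Y hUd hU'd hU''d hU₃c hκ₀ hκ₁ ha hτ hδ hθ0 hθ1 hκθ hκθw hstab hU'b hU''b hU₃b hlam hUsec hρg hHk
      hHk0 hK3 hK30 ψ hαr hαc hhr hlamA hlamA1 hγ hγ1 hD hDC hθnn hDθr hdθ hDθc hdθ' hσ0 hσθ hr1 hrσ haσ hβ haσ' hgσ hgσ' hC4 x y z t s
  have h2 := ((congrArg abs (u4_swap12_pt _ _ _ _ _ _ _ _ _ _ _)).trans_le (hess_fourth_cumulant_entry_tilted hΓop Y hUd hU'd hU''d hU₃c hκ₀ hκ₁ ha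
      hτ hδ hθ0 hθ1 hκθ hκθw hstab hU'b hU''b hU₃b hlam hUsec hρg hHk hHk0 hK3 hK30 ψ hαr hαc hhr hlamA hlamA1 hγ hγ1 hD hDC hθnn hDθr hdθ hDθc hdθ'
      hσ0 hσθ hr1 hrσ haσ hβ haσ' hgσ hgσ' hC4 x z y t s))
  have h3 := ((congrArg abs (u4_3124_pt _ _ _ _ _ _ _ _ _ _ _)).trans_le (hess_fourth_cumulant_entry_tilted hΓop Y hUd hU'd hU''d hU₃c hκ₀ hκ₁ ha hτ
      hδ hθ0 hθ1 hκθ hκθw hstab hU'b hU''b hU₃b hlam hUsec hρg hHk hHk0 hK3 hK30 ψ hαr hαc hhr hlamA hlamA1 hγ hγ1 hD hDC hθnn hDθr hdθ hDθc hdθ' hσ0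
      hσθ hr1 hrσ haσ hβ haσ' hgσ hgσ' hC4 x t y z s))
  have h4 := ((congrArg abs (u4_cyc_pt _ _ _ _ _ _ _ _ _ _ _)).trans_le (hess_fourth_cumulant_entry_tilted hΓop Y hUd hU'd hU''d hU₃c hκ₀ hκ₁ ha hτ
      hδ hθ0 hθ1 hκθ hκθw hstab hU'b hU''b hU₃b hlam hUsec hρg hHk hHk0 hK3 hK30 ψ hαr hαc hhr hlamA hlamA1 hγ hγ1 hD hDC hθnn hDθr hdθ hDθc hdθ' hσ0
      hσθ hr1 hrσ haσ hβ haσ' hgσ hgσ' hC4 x s y z t))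
  have h5 := ((congrArg abs (u5_cyc_pt _ _ _ _ _ _ _ _ _ _ _ _ _)).trans_le (fifth_cumulant_entry_tilted hΓop Y hUd hU'd hU''c hκ₀ hκ₁ ha hτ hδ hθ0
      hθ1 hκθ hκθw hstab hU'b hU''b hlam hUsec hρg hHk hHk0 ψ hαr hαc hhr hlamA hlamA1 hγ hγ1 hD hDC hθnn hDθr hdθ hDθc hdθ' hσ0 hσθ hr1 hrσ haσ hβ
      haσ' hC5 x y z t s))
  beta_reduce at h2 h3 h4 h5
  exact (abs_split_u4 _ _ _ _ _ ).trans (add_le_add (add_le_add (add_le_add (add_le_add h1 h2) h3) h4) h5)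

/-! ## Toy -/

/-- Toy (placements bounded in this file). -/
example : 5 = 5 := by norm_num

end Summit.QuantumFields.BalabanUV.T4Continuum.NE7b.SupFifthKernelEntryGroupFive

end
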